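import Summits.RiemannHypothesis.RiemannHypothesis.Theorems.TiltedLandingLaw421R3Lens1CoverageRS

/-!
# Lens-1 file RS2 v2 (v10q+ image helper) — the SUCC residual in LINEAGE currency `RegHungCut10S` (lens-1 g3; crit-1 CUT 6 ask, 2026-08-30)

RH is not proved; nothing here bears on the truth of RH; 33346/33347 OPEN. Imports `…R3Lens1CoverageRS` (= `lens-1/CoverageRS-v1.lean` af697aca, rung (3i′),
landing after (3i) `…R3Lens1SignCut`). CHECK STATUS: by-import check impossible until RS lands; the inline probe `lens-1/CoverageRS2-v2-probe.lean` (landed R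
imported; S v2, RS v1 bodies inlined verbatim; this body appended) is farm rc 0 · 0 sorry · STD axioms for every theorem below.

crit-1 CUT 6 (STATUS 22:09Z): «type the SUCC residual in LINEAGE currency — the complement of `succ_of_columnCuttable_upTo`: some level i ≤ j has a column couple NOT
column-cuttable ∧ binders ⇒ successor; that residual is A3′'s cluster-spanning configuration and nothing else». This file does exactly that, plus the PROVED inhabitant shape `inhabitant_shape` ((CA494) O2 in lineage currency):
`RegHungCut10S` := the binders/exclusions of `RegHung9S` VERBATIM + «∃ i ≤ j, ¬ ColumnCuttable f x₀ R Hs i» ⇒ ∃ level-(j+1) band state; the lineage door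
`RhW08.Lens1SignCut.succ_of_columnCuttable_upTo` discharges the complement, so `RegHungCut10S ↔ RegHung9S` in the kernel (both directions below) — the registry
exposure is RENAMED into lineage currency, not moved (cf. (CA492)). A prover handed `RegHungCut10S` is told in the statement itself that the configuration to
beat has an UNCUTTABLE column couple at some level i ≤ j (sign set of `Im(F_i′/F_i)` edge-connected to a column wall) AND no hung signed box at level j — crit-1's
exhibit G (HANDS-30) read as an `F_2` is of this shape (no column couple at level 2 ⇒ by `colCouple_succ_of_cuttable` some level ≤ 1 was uncuttable or Ready).
-/

namespace RhW08.Lens1Coverage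

set_option linter.dupNamespace false

open Complex Set
open scoped ComplexConjugate
open Literature.Analysis.Complex
open Summit.RiemannHypothesis.RiemannHypothesis.Theorems.Splittings.JensenWindow
open RhIdea6.G17.W07C7 RhIdea6.G17.W07C7.Rev6 RhIdea6.G18.W07C8.Law421BirthS RhIdea6.G19.W07C11.Seam
open RhIdea6.G20.W07C12.Frac RhIdea6.G20.W07C12.StColP RhW07.C12.FieldSplit RhIdea6.G21.W07C13.TentMax
open RhW07.C14.TwoSided RhW07.C14.Classes RhW07.C14.Lineage RhW07.C14.Booking
open RhW07.C13.Heredity RhIdea6.G22.W07C15pre.Injection RhW07.E3.Cell RhW07.E3.Lit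
open RhW08.Round1 RhW08.StSwap RhW08.Round2 RhW08.QuadW RhW08.SealSwapQ RhW08.SealSwap RhW08.SuccB RhW08.SuccSplit
open RhW08.SuccTheft RhW08.Column RhW08.Hurwitz RhW08.ClusterQ RhW08.ClusterQM RhW08.NewtonDoor RhW08.NewtonDoorGenusOne RhW08.PurseP
open RhW08.AntiEscapeSplit7

open RhW08.Lens1SignCut

/-- ★ THE SUCC RESIDUAL IN LINEAGE CURRENCY `RegHungCut10S` (OPEN): binders/exclusions of `RegHung9S` verbatim, plus «some level `i ≤ j` is NOT
column-cuttable» ⇒ a level-`(j+1)` band state.  WHY IT MIGHT FAIL: A3′ (column-lineage surfing + terminal steal, crit-1 HANDS-30) — an in-class frame whose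
central lineage escapes laterally through an uncuttable cluster and whose last child is stolen out of the level-(j+1) window. -/
def RegHungCut10S : Prop :=
  ∀ (η : ℝ) (f : ℂ → ℂ) (x₀ s hmax R Hs : ℝ) (B : ℕ), EngineHyps5 2 η f x₀ s hmax R Hs B → ∀ (j : ℕ) (v : ℂ),
    IsLowest StTrkDQ η f x₀ s hmax R Hs B j v → ¬ ReadyR2 η f x₀ s hmax R Hs B j v →
    ¬ AllInBandInRangeWindow f x₀ R Hs j v → ¬ Dimple f j v → DiscOverlap f j v →
    iteratedDeriv (j + 1) f v ≠ 0 →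
    ¬ CellF f j v → ¬ CellNb f x₀ R Hs j v → ¬ LandingDipDeep f x₀ R Hs j v → ¬ LandingDipW f x₀ R Hs j v →
    ¬ IsolatedNewtonL f x₀ R Hs j v → ¬ HungBox f x₀ R Hs j → (∃ i : ℕ, i ≤ j ∧ ¬ ColumnCuttable f x₀ R Hs i) →
    ∃ u : ℂ, StTrkDQ η f x₀ s hmax R Hs B (j + 1) u

/-- Monotonicity: `RegHung9S ⇒ RegHungCut10S` (one more hypothesis, ignored). -/
theorem regHungCut10S_of_regHung9S (hX : RegHung9S) : RegHungCut10S :=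
  fun η f x₀ s hmax R Hs B hE j v hlow hnR hwin hdim hov hz hnF hnNb hnD hnW hnI hB _ =>
    hX η f x₀ s hmax R Hs B hE j v hlow hnR hwin hdim hov hz hnF hnNb hnD hnW hnI hB

/-- ★ The lineage door discharges the new binder: `RegHungCut10S ⇒ RegHung9S` (`RhW08.Lens1SignCut.succ_of_columnCuttable_upTo`). -/
theorem regHung9S_of_regHungCut10S (hX : RegHungCut10S) : RegHung9S := by
  intro η f x₀ s hmax R Hs B hE j v hlow hnR hwin hdim hov hz hnF hnNb hnD hnW hnI hB
  by_cases hcut : ∀ i : ℕ, i ≤ j → ColumnCuttable f x₀ R Hs i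
  · exact succ_of_columnCuttable_upTo v hE hnR hcut
  obtain ⟨i, hi⟩ := not_forall.mp hcut
  exact hX η f x₀ s hmax R Hs B hE j v hlow hnR hwin hdim hov hz hnF hnNb hnD hnW hnI hB ⟨i, Classical.not_imp.mp hi⟩

/-- Hence also `RegHungCut10S ⇒ RegRes8S` (v8q currency). -/
theorem regRes8S_of_regHungCut10S (hX : RegHungCut10S) : RegRes8S :=
  regRes8S_of_regHung9S (regHung9S_of_regHungCut10S hX)

/-- ★★ THE CRUX BY NAME from the lineage-currency stub and lens-2's `RateLawsHalfQ`. -/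
theorem TiltedLandingLaw421R_of_regHungCut10S (hX : RegHungCut10S) (hR : RhW08.RateSplit.RateLawsHalfQ) :
    Summit.RiemannHypothesis.RiemannHypothesis.Theses.EarlyAppointments.TiltedLandingLaw421R :=
  TiltedLandingLaw421R_of_regHung9S (regHung9S_of_regHungCut10S hX) hR

/-- ★ INHABITANT SHAPE in lineage currency ((CA494) O2, proved): if some level `≤ j` is not column-cuttable (the extra binder of `RegHungCut10S`)
at a non-`ReadyR2` level `j`, then at the FIRST such level `i₀` every lower level is cuttable, the central lineage has delivered a column couple at
EVERY level `≤ i₀` (`colCouple_succ_of_cuttable` from the booked pair `w₀`), and that level-`i₀` column couple admits no signed bracket inside the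
closed column — i.e. the configuration a prover/adversary must handle is «a column couple of `f^{(i₀)}` edge-connected (through the set where the
boundary sign fails at some height `≤ Hs`) to a column wall», nothing else (crit-1 A3′). -/
theorem inhabitant_shape {η : ℝ} {f : ℂ → ℂ} {x₀ s hmax R Hs : ℝ} {B j : ℕ} (v : ℂ)
    (hE : EngineHyps5 2 η f x₀ s hmax R Hs B) (hnR : ¬ ReadyR2 η f x₀ s hmax R Hs B j v)
    (h : ∃ i : ℕ, i ≤ j ∧ ¬ ColumnCuttable f x₀ R Hs i) :
    ∃ i₀ : ℕ, i₀ ≤ j ∧ ¬ ColumnCuttable f x₀ R Hs i₀ ∧ (∀ i : ℕ, i < i₀ → ColumnCuttable f x₀ R Hs i) ∧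
      (∀ k : ℕ, k ≤ i₀ → ColCouple f x₀ R k) := by
  classical
  have hspec := Nat.find_spec h
  have hmin : ∀ i : ℕ, i < Nat.find h → ColumnCuttable f x₀ R Hs i := by
    intro i hi
    by_contra hc
    exact Nat.find_min h hi ⟨by have := hspec.1; omega, hc⟩
  refine ⟨Nat.find h, hspec.1, hspec.2, hmin, ?_⟩
  have hRpos : 0 < R := R_pos_of_engine hE
  intro k
  induction k with
  | zero =>
    intro _
    obtain ⟨w₀, hw₀, hw₀im, hw₀re, -⟩ := hE.2.2.2.2.2.2.2.2.2.2.1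
    exact ⟨w₀, by rw [iteratedDeriv_zero]; exact hw₀, hw₀im, by rw [hw₀re, sub_self, abs_zero]; linarith⟩
  | succ k ih =>
    intro hk
    have hkj : k ≤ j := by have := hspec.1; omega
    have hnRk : ¬ ReadyR2 η f x₀ s hmax R Hs B k v := fun h' => hnR (readyR2_mono h' hkj)
    have hnW : ¬ WindowReady η f x₀ s hmax R Hs B k v := fun hW => hnRk (cumReady_of_ready (Ready := WinOrTilt) (Or.inl hW))
    exact colCouple_succ_of_cuttable v hE (RhW08.LineageQ.iteratedDeriv_ne_zero_of_not_readyR2 hE k v hnRk).1 (ih (by omega)) (hmin k (by omega)) hnW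

end RhW08.Lens1Coverage
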